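import Summits.ResolutionOfSingularities.ResolutionOfSingularities.Theorems.FrobeniusClosingSteerCore4IsoIsol
import HarnessLib

/-!
# Crux `Steer` (stmt-16345), r9 `stub_core4Iso`, piece I — the ELEMENTWISE end condition (r9's `IsolAt`)

OURS (campaign `res-hironaka`, rung L, slot W4.1, chain W4.1; replaces the role of no printed item; NOT a
statement of the manuscript under review). The registered r9 vocabulary states isolation ELEMENTWISE
(`IsolAt O S f`: some power of every element of the centre lies in the intrinsic Jacobian ideal
`(δ f : δ ∈ Der_ℤ S)`), whereas `isol_transfer` (p479356) takes the IDEAL form `centre ^ N ≤ (δ f : δ)`. For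
a regular local (hence Noetherian) `R`, the two agree up to the exponent (`𝔪` finitely generated,
`Ideal.exists_pow_le_of_le_radical_of_fg`); this file PROVES the elementwise wrapper and the typed-`Isol`
reading (finiteness of `κ⟦X⟧ ⧸ (∂₁ φf, …, ∂_d φf)`), as asked by the chain planner (CRUX-PLAN-Steer v2 §B,
seam I end condition). No `Theses.*` / `Cruxes.*` import. [folklore]
-/

noncomputable section

-- layout-mandated namespace `Summit.<Summit>.<Problem>.…` with Summit = Problem (single-conjunct summit)
set_option linter.dupNamespace false

open MvPowerSeries IsLocalRing
open Literature.AlgebraicGeometry.Resolution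

namespace Summit.ResolutionOfSingularities.ResolutionOfSingularities.Theorems.SwitchingDichotomy.Isol

/-- **Elementwise ⇒ ideal-power form of isolation** (Noetherian `R`): if some fixed power of every
element of the centre of `O` on `R` lies in an ideal `J`, then some power of the centre lies in `J`.
[folklore] -/
theorem exists_centre_pow_le_of_elementwise {K : Type} [Field K] (O : ValuationSubring K)
    (R : Subring K) (hR : R ≤ O.toSubring) [IsNoetherianRing R] (J : Ideal R) (N : ℕ)
    (h : ∀ y : R, O.valuation (y : K) < 1 → y ^ N ∈ J) :
    ∃ N' : ℕ, Ideal.comap (Subring.inclusion hR) (IsLocalRing.maximalIdeal O) ^ N' ≤ J := by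
  refine Ideal.exists_pow_le_of_le_radical_of_fg (fun y hy => ⟨N, h y ?_⟩) (IsNoetherian.noetherian _)
  rw [Ideal.mem_comap] at hy
  exact (ValuationSubring.valuation_lt_one_iff O _).mp hy

/-- **I `isol_transfer`, elementwise form (r9's `IsolAt`).** Under a formal chart `φ : R → κ⟦X₁..X_d⟧` of a
regular local `R ⊆ O` dominated by `O` (perfect residue field, characteristic `p`) whose centre generates
`(X)`: if some power of every element of the centre lies in `(δ f : δ ∈ Der_ℤ(R,R))`, then some power of
`(X)` lies in `(∂₁ φf, …, ∂_d φf)`. [folklore] -/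
theorem isol_transfer_of_elementwise {K : Type} [Field K] (O : ValuationSubring K) {κ : Type} [Field κ]
    (p : ℕ) [Fact p.Prime] [CharP K p] [CharP κ p] [PerfectField κ]
    (R : Subring K) (hR : R ≤ O.toSubring) [IsRegularLocalRing R] (hdom : SubringDominates R O.toSubring)
    [PerfectField (IsLocalRing.ResidueField R)]
    (d : ℕ) (hd : (IsLocalRing.maximalIdeal R).spanFinrank = d) (φ : R →+* MvPowerSeries (Fin d) κ)
    (h2 : Ideal.map φ (Ideal.comap (Subring.inclusion hR) (IsLocalRing.maximalIdeal O)) =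
      Ideal.span (Set.range (X : Fin d → MvPowerSeries (Fin d) κ)))
    (f : R) (N : ℕ)
    (hN : ∀ y : R, O.valuation (y : K) < 1 →
      y ^ N ∈ Ideal.span (Set.range fun δ : Derivation ℤ R R => δ f)) :
    ∃ N' : ℕ, Ideal.span (Set.range (X : Fin d → MvPowerSeries (Fin d) κ)) ^ N' ≤
      Ideal.span (Set.range fun l : Fin d => MvPowerSeries.pderiv l (φ f)) := by
  obtain ⟨N', hN'⟩ := exists_centre_pow_le_of_elementwise O R hR _ N hN
  exact ⟨N', isol_transfer O p R hR hdom d hd φ h2 f N' hN'⟩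

/-- **The typed-`Isol` reading**: under the hypotheses of `isol_transfer_of_elementwise`, the Jacobian
algebra `κ⟦X₁..X_d⟧ ⧸ (∂₁ φf, …, ∂_d φf)` of the chart image is finite-dimensional over `κ` (the `Isol`
predicate of `IsolatedForcedTermination` for the series `φ f`). [folklore] -/
theorem finite_quotient_span_pderiv_of_elementwise {K : Type} [Field K] (O : ValuationSubring K)
    {κ : Type} [Field κ] (p : ℕ) [Fact p.Prime] [CharP K p] [CharP κ p] [PerfectField κ]
    (R : Subring K) (hR : R ≤ O.toSubring) [IsRegularLocalRing R] (hdom : SubringDominates R O.toSubring)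
    [PerfectField (IsLocalRing.ResidueField R)]
    (d : ℕ) (hd : (IsLocalRing.maximalIdeal R).spanFinrank = d) (φ : R →+* MvPowerSeries (Fin d) κ)
    (h2 : Ideal.map φ (Ideal.comap (Subring.inclusion hR) (IsLocalRing.maximalIdeal O)) =
      Ideal.span (Set.range (X : Fin d → MvPowerSeries (Fin d) κ)))
    (f : R) (N : ℕ)
    (hN : ∀ y : R, O.valuation (y : K) < 1 →
      y ^ N ∈ Ideal.span (Set.range fun δ : Derivation ℤ R R => δ f)) :
    Module.Finite κ (MvPowerSeries (Fin d) κ ⧸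
      Ideal.span (Set.range fun l : Fin d => MvPowerSeries.pderiv l (φ f))) := by
  obtain ⟨N', hN'⟩ := isol_transfer_of_elementwise O p R hR hdom d hd φ h2 f N hN
  haveI : Finite (Fin d) := inferInstance
  rw [← maximalIdeal_mvPowerSeries_eq_span] at hN'
  exact finite_quotient_of_maximalIdeal_pow_le hN'

end Summit.ResolutionOfSingularities.ResolutionOfSingularities.Theorems.SwitchingDichotomy.Isol

end
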